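import Literature.MathematicalPhysics.QuantumFieldTheory.Balaban1983to89.B9Eq323TowerBlockPoincare
import Literature.MathematicalPhysics.QuantumFieldTheory.Balaban1983to89.B9Eq319QprimeTowerBlockLocal
import Literature.MathematicalPhysics.QuantumFieldTheory.Balaban1983to89.B9Eq332QprimeTowerGaugeCovariance
import Literature.MathematicalPhysics.QuantumFieldTheory.Balaban1983to89.B9Eq324DeltaPrimeATower

/-!
# `Balaban1983to89.B9Thm311SitePrimeFormCoerciveTowerBlockGauge` — T. Bałaban, *Propagators for lattice gauge theories in a background field*, Commun.
# Math. Phys. **99** (1985) 389–434 [Balaban1985BackgroundPropagators] (3.24) p. 394, (3.31)–(3.32) p. 395, (3.35) p. 396, Thm 3.11 p. 416, with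
# [Balaban1983RegularityDecay] (2.27) p. 580 and [Balaban1984PropagatorsI] (1.18) p. 20: **THE k-LEVEL SITE OPERATOR `Δ′_{a′,k}(U) = D*_UD_U +
# a′Q′_k(U)*Q′_k(U)` IS STRONGLY COERCIVE AT EVERY BACKGROUND WHOSE UNIT BLOCKS CARRY A SMALL-BOND GAUGE** —
# `(1∕(3+4∕a′))·(‖D_Uλ‖² + (1 − κ_k)(ηL^{n+1})⁻²‖λ‖²) ≤ re⟨λ, Δ′_{a′,k}(U)λ⟩`, `κ_k = 2d(N−1)N·ε² + 4ρ_k²`, `ρ_k = Π_{j≤n}(1+ε_j)^{d(L−1)} − 1`, `N = L^{n+1}` —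
# the k-level twin of `B9Thm311SitePrimeFormCoerciveBlockGauge` ((T4) of the tower Tier P programme): block Poincaré with means on the unit block of side
# `L^{n+1}`, run block by block in the block's own gauge; no global bond window, no closed line

statement-level skeleton of published theorems with citation tags; proofs where landed; nothing here is a claim about the Yang–Mills mass gap

CITATION HEADER (lean-in-tree rule).  Audit cell `pub-balaban`, sub-cell `t4`, BINDER row NE9; filed by NE9 formalisation-swarm leaf prover 03
(`b2b-balaban-t4-ne9-formalise-leaf-03`, gen 64), brick (T4) of the k-level Tier P programme (journal l.47756).  Sources READ in the held text: [B9]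
pp. 394–396, 416 (`paper:balaban1985-cmp99-background-propagators`); [B4] p. 580 and [B5] p. 20 via the verbatim headers of `B9Eq323FlatBlockPoincare` ∕
`B9Eq316TowerFlatIsOneStep`.  Objects BY NAME: the owner's `towerP` ∕ `UlevOf` ∕ `QprimeTowerW` ∕ `laplacePrimeAk` ∕ `re_inner_laplacePrimeAk` ∕
`QprimeTower_flat_apply` ∕ `towerP_eq_fineP_pow` ∕ `siteCast`, this lineage's (P1) `sum_block_norm_sq_le_poincare_mean` (at block side `L^{n+1}`),
(T3) `norm_QprimeTowerW_sub_flat_apply_le_local`, (T2′) `norm_QprimeTowerW_gaugeU`, the chain's `gaugeU` ∕ `gaugeW` ∕ `AdW` ∕ `covDerivL2K_gaugeU`;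
nothing re-declared, 0 `def`.

THE PRINT (verbatim).  [B9] p. 394 (3.24): *«Δ′_a = Δ′_a(U) = D*_U D_U + Q′* a Q′»*; p. 395 (3.31)–(3.32): *«D_{U^u}R(u)λ = R(u)D_Uλ, Q′(U^u)R(u)λ =
R(u)Q′(U)λ»*, *«Δ′_a is positive»*; p. 396 (3.35): *«there exists a gauge transformation u on □ such that U^u = e^{iηA} …»*; Thm 3.11 p. 416:
*«Δ′_a, G′ … are positive definite»*.  [B4] (2.27) p. 580: the block Poincaré inequality.  [B5] (1.18) p. 20: *«L replaced by L^k»*.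

WHAT IS PROVED (sorry-free; proof lane — 0 `def`; [folklore] transport + the (P1) argument one storey up).
* §1 transport to the unit block of `T_{L^{n+1}m}` («`x` over `y`» = `x_i div L^{n+1} = y_i`): `sum_over_eq_sum_blockOf_cast`, `sum_bond_over_eq_cast`,
  **`sum_over_norm_sq_le_poincare_mean`** ((P1) §1 at block side `L^{n+1}` through `towerP_eq_fineP_pow` ∕ `siteCast`: `Σ_{x over y}‖g x‖² ≤
  (N−1)N·Σ_{b internal over y}‖g(b₊) − g(b₋)‖² + 2N^d‖N^{−d}Σ_{x over y} g x‖²`), `overMean_norm_sq_le` (Jensen), `sum_over_sum` (`Σ_y Σ_{x over y} = Σ_x`).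
* §2 **`sum_over_norm_sq_le_blockGauge_tower`** — AT `U`, ONE UNIT BLOCK, IN THE BLOCK's GAUGE: with `h = R(g_y)λ`, `Ũ = U^{g_y}` (fine bonds over `y`
  `ε`-close, level-`(j+1)` bonds over `y` internal to level-`j` blocks `ε_j`-close, in this gauge):
  `Σ_{x over y}‖λ x‖² ≤ (N−1)N·Σ_{b internal over y}(2η²‖(D_Uλ)(b)‖² + 2ε²‖λ(b₊)‖²) + 4N^d‖(Q′_k(U)λ)(y)‖² + 4ρ_k²·Σ_{x over y}‖λ x‖²` —
  (3.31) `covDerivL2K_gaugeU`, (3.32) `norm_QprimeTowerW_gaugeU` (under the class (52) for the covariance of the nonlinear averages), the local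
  composite letter `norm_QprimeTowerW_sub_flat_apply_le_local`, `QprimeTower_flat_apply`.
* §3 **`norm_sq_le_site_squares_blockGauge_tower`** (summed over the blocks, chain currency: `(1 − κ_k)‖λ‖² ≤ 2(N−1)Nη²‖D_Uλ‖² +
  4(c₀N^d∕c₁)‖Q̃′_k(U)λ‖²`) and **`site_strong_coercive_blockGauge_tower`** (`(1∕(3 + 4∕a′))·(‖D_Uλ‖² + (1 − κ_k)(ηN)⁻²‖λ‖²) ≤ re⟨λ, Δ′_{a′,k}(U)λ⟩`
  along `c₁(ηN)² = c₀N^d`, `0 < ηN`; `re_inner_laplacePrimeAk`).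
WHY ∕ HONEST SCOPE.  The gauges and their two smallness profiles are DISPLAYED here; `B7Eq47BlockGaugeTowerBonds` (T2) inhabits them from the plaquette
class (52) with `ε = d(N−1)·pdev`, `ε_j = (d + 256(d+1)(d+4))α₀L^{n−j}∕N` in the block axial gauges — the discharge (T5) is the next file.  [folklore]
bookkeeping; nothing of [B9] asserted; NOT the bond operator, NOT `G′_k`, NOT the `R`-road.  NOT summit progress (cell pub-balaban: NE9 NOT PRINTED ∕
NOT PROVED; «NE9 ⇐ the named binders»; spine PROVED 0/9; rung (B)+1 finite T⁴ — NOT infinite volume, NOT mass gap, NOT Clay; HONEST DEPENDENCY: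
continuum YM on T⁴ ⇐ BetaPertH ∧ nine spine estimates (0/9 proved); BetaPertH ⇐ (D1) ∧ (D4) ∧ CAP+tail; G-an2-4 gates asym, D1 and NE2/3/4).
NEW file; nothing modified.  Net new unproved facts: 0.
-/

noncomputable section

open scoped BigOperators InnerProductSpace ComplexConjugate

namespace Literature.MathematicalPhysics.QuantumFieldTheory.Balaban1983to89.B9Thm311SitePrimeFormCoerciveTowerBlockGauge

open B4Sect5Torus (TSite)
open B9SectCLatticeCarrier (Bond shift)
open B9Eq311L2Pairing (WL2)
open B9Eq319QprimeTorus (fineP blockCoord mem_blockOf_iff)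
open B11Eq103H1Complex (SiteL2K covDerivL2K equiv_covDerivL2K)
open B9Eq310HessianOperator (adTransportW)
open B9Eq315QTower (towerP UlevOf QprimeTower)
open B9Eq326OperatorTower (QprimeTowerW)
open B9Eq324DeltaPrimeATower (laplacePrimeAk re_inner_laplacePrimeAk)
open B9Eq328GaugeAction (gaugeU AdW gaugeW equiv_gaugeW covDerivL2K_gaugeU)
open B9Eq316TowerFlatIsOneStep (towerP_eq_fineP_pow siteCast siteCast_apply_val siteCast_symm QprimeTower_flat_apply)
open B5Eq172FlatCoercivity (card_blockOf)
open B9Thm311SitePrimeFormCoerciveBlockGauge (norm_AdW_of_inner)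
open B9Eq323TowerBlockPoincare (sum_over_norm_sq_le_poincare_mean overMean_norm_sq_le sum_over_sum sum_bond_internal_le sum_bond_tgt_eq_tower)
open B9Eq319QprimeTowerBlockLocal (norm_QprimeTowerW_sub_flat_apply_le_local)
open B9Eq332QprimeTowerGaugeCovariance (norm_QprimeTowerW_gaugeU)
open B9Eq33CovDerivVector (covDeriv_apply_dir shiftEquiv)
open B7Prop1Explicit (U1)
open B7Prop2Explicit (pdev C0 c2' AvgClosed)
open B9Eq315QTorus (perCfg)

variable {d : ℕ} (L : ℕ) [NeZero L] (m : Fin d → ℕ) (n : ℕ)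
/-! ## §2 At `U`, one unit block, in the block's gauge -/

section Block

variable [∀ i, NeZero (m i)] {𝔸 : Type*} [NormedRing 𝔸] [NormOneClass 𝔸] [NormedAlgebra ℂ 𝔸] [CompleteSpace 𝔸]
  {W : Type*} [NormedAddCommGroup W] [InnerProductSpace ℂ W] [FiniteDimensional ℂ W] (φ : W ≃ₗ[ℂ] 𝔸) {c₀ : ℝ} [Fact (0 < c₀)]
  {η : ℝ} (hη : η ≠ 0) (hL : 2 ≤ L) {S : Subgroup 𝔸ˣ} (hS : AvgClosed d L S)
  (U : Bond d (towerP L m (n + 1)) → 𝔸ˣ) (hU : ∀ b, U b ∈ S)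
  {α₀ : ℝ} (hα : 0 < α₀) (hα3 : C0 d * α₀ ≤ 1 / 3) (hα2 : 2 * α₀ ≤ c2' d L)
  (h52 : pdev (perCfg (towerP L m (n + 1)) U) < α₀ * (((L : ℝ) ^ (n + 1))⁻¹) ^ 2)
  (g : TSite d m → TSite d (towerP L m (n + 1)) → 𝔸ˣ) (hgU1 : ∀ y x, g y x ∈ U1 𝔸)
  (hAd : ∀ (y : TSite d m) (x : TSite d (towerP L m (n + 1))) (v v' : W), ⟪AdW φ (g y x) v, AdW φ (g y x) v'⟫_ℂ = ⟪v, v'⟫_ℂ)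
  {ε : ℝ} (hε : 0 ≤ ε) (εlev : ℕ → ℝ) (hεlev : ∀ j, 0 ≤ εlev j)
  (hR : ∀ (y : TSite d m) (x : TSite d (towerP L m (n + 1))) (μ : Fin d), (∀ i, (x i : ℕ) / L ^ (n + 1) = (y i : ℕ)) →
    (∀ i, ((shift μ x) i : ℕ) / L ^ (n + 1) = (y i : ℕ)) → ∀ w, ‖adTransportW φ (gaugeU (g y) U) (x, μ) w - w‖ ≤ ε * ‖w‖)
  (hRlev : ∀ (y : TSite d m), ∀ j < n + 1, ∀ (x : TSite d (towerP L m (j + 1))) (μ : Fin d),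
    blockCoord L (towerP L m j) x = blockCoord L (towerP L m j) (shift μ x) → (∀ i, (x i : ℕ) / L ^ (j + 1) = (y i : ℕ)) →
      ∀ w, ‖adTransportW φ (UlevOf L m (n + 1) (gaugeU (g y) U) j) (x, μ) w - w‖ ≤ εlev j * ‖w‖)

include hη hL hS hU hα hα3 hα2 h52 hgU1 hAd hε hεlev hR hRlev in
/-- **THE GAUGED UNIT-BLOCK ESTIMATE AT k LEVELS**: at the unit block `y` of `T_{L^{n+1}m}`, with `h := R(g y)λ` and `Ũ := U^{g y}` (fine bonds over `y`
`ε`-close, level bonds over `y` `ε_j`-close, IN THIS GAUGE; `N = L^{n+1}`):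
`Σ_{x over y}‖λ x‖² ≤ (N−1)N·Σ_{b over y, b₊ over y}(2η²‖(D_Uλ)(b)‖² + 2ε²‖λ(b₊)‖²) + 4N^d‖(Q′_k(U)λ)(y)‖² + 4ρ_k²·Σ_{x over y}‖λ x‖²`,
`ρ_k = Π_{j≤n}(1+ε_j)^{d(L−1)} − 1` — Poincaré with means for `h` (§1); `‖h(b₊) − h(b₋)‖ ≤ |η|‖(D_Ũh)(b)‖ + ε‖h(b₊)‖` and (3.31)
`(D_Ũh)(b) = R(g y b₋)(D_Uλ)(b)`; `mean h = (Q′_k(1)h)(y)` (`QprimeTower_flat_apply`), (3.32) `‖(Q′_k(Ũ)h)(y)‖ = ‖(Q′_k(U)λ)(y)‖`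
(`norm_QprimeTowerW_gaugeU`, under the class (52)), and the local composite letter `‖(Q′_k(Ũ)h)(y) − (Q′_k(1)h)(y)‖ ≤ ρ_k·N^{−d}Σ‖h‖`.
[cite: Balaban1985BackgroundPropagators, (3.31)–(3.32) p.395, (3.35) p.396, Thm 3.11 p.416; Balaban1983RegularityDecay, (2.27) p.580; Balaban1984PropagatorsI, (1.18) p.20] -/
theorem sum_over_norm_sq_le_blockGauge_tower (lam : SiteL2K ℂ d (towerP L m (n + 1)) c₀ W) (y : TSite d m) :
    ∑ x ∈ Finset.univ.filter (fun x : TSite d (towerP L m (n + 1)) => ∀ i, (x i : ℕ) / L ^ (n + 1) = (y i : ℕ)),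
        ‖WL2.equiv ℂ (fun _ : TSite d (towerP L m (n + 1)) => c₀) W lam x‖ ^ 2 ≤
      2 * ((((L ^ (n + 1) - 1 : ℕ) : ℝ)) * ((L ^ (n + 1) - 1 : ℕ) + 1) / 2) *
          ∑ b ∈ Finset.univ.filter (fun b : Bond d (towerP L m (n + 1)) =>
            (∀ i, (b.1 i : ℕ) / L ^ (n + 1) = (y i : ℕ)) ∧ ∀ i, ((shift b.2 b.1) i : ℕ) / L ^ (n + 1) = (y i : ℕ)),
            (2 * η ^ 2 * ‖WL2.equiv ℂ (fun _ : Bond d (towerP L m (n + 1)) => c₀) W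
                (covDerivL2K ℂ c₀ ((η : ℂ))⁻¹ (adTransportW φ U) lam) b‖ ^ 2 +
              2 * ε ^ 2 * ‖WL2.equiv ℂ (fun _ : TSite d (towerP L m (n + 1)) => c₀) W lam (shift b.2 b.1)‖ ^ 2) +
        4 * ((L : ℝ) ^ (n + 1)) ^ d * ‖QprimeTowerW L m n φ U (c₀ := c₀) lam y‖ ^ 2 +
        4 * ((∏ j ∈ Finset.range (n + 1), (1 + εlev j) ^ (d * (L - 1))) - 1) ^ 2 *
          ∑ x ∈ Finset.univ.filter (fun x : TSite d (towerP L m (n + 1)) => ∀ i, (x i : ℕ) / L ^ (n + 1) = (y i : ℕ)),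
            ‖WL2.equiv ℂ (fun _ : TSite d (towerP L m (n + 1)) => c₀) W lam x‖ ^ 2 := by
  classical
  set N : ℝ := ((L : ℝ) ^ (n + 1)) ^ d with hNdef
  set S' := Finset.univ.filter (fun x : TSite d (towerP L m (n + 1)) => ∀ i, (x i : ℕ) / L ^ (n + 1) = (y i : ℕ)) with hS'
  set f := WL2.equiv ℂ (fun _ : TSite d (towerP L m (n + 1)) => c₀) W lam with hfdef
  set h := gaugeW φ (g y) lam with hhdef
  set hf := WL2.equiv ℂ (fun _ : TSite d (towerP L m (n + 1)) => c₀) W h with hhfdef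
  set Ut := gaugeU (g y) U with hUt
  set Df := WL2.equiv ℂ (fun _ : Bond d (towerP L m (n + 1)) => c₀) W (covDerivL2K ℂ c₀ ((η : ℂ))⁻¹ (adTransportW φ U) lam) with hDf
  set ρ := (∏ j ∈ Finset.range (n + 1), (1 + εlev j) ^ (d * (L - 1))) - 1 with hρdef
  have hρ0 : 0 ≤ ρ := by
    rw [hρdef]; exact sub_nonneg.2 (Finset.one_le_prod (s := Finset.range (n + 1)) fun j _ => one_le_pow₀ (by linarith [hεlev j]))
  have hN0 : (0 : ℝ) < N := by rw [hNdef]; exact pow_pos (pow_pos (by exact_mod_cast Nat.pos_of_ne_zero (NeZero.ne L)) _) _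
  -- pointwise readings of the gauged parameter
  have hhf : ∀ x, hf x = AdW φ (g y x) (f x) := fun x => by rw [hhfdef, hhdef, equiv_gaugeW]
  have hnorm : ∀ x, ‖hf x‖ = ‖f x‖ := fun x => by rw [hhf, norm_AdW_of_inner φ (hAd y x)]
  -- (3.31): the covariant derivative of `h` at `Ũ`, pointwise
  have hD : ∀ (x : TSite d (towerP L m (n + 1))) (μ : Fin d),
      ((η : ℂ))⁻¹ • (adTransportW φ Ut (x, μ) (hf (shift μ x)) - hf x) = AdW φ (g y x) (Df (x, μ)) := fun x μ => by
    have h1 : WL2.equiv ℂ (fun _ : Bond d (towerP L m (n + 1)) => c₀) W (covDerivL2K ℂ c₀ ((η : ℂ))⁻¹ (adTransportW φ Ut) h) (x, μ) =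
        ((η : ℂ))⁻¹ • (adTransportW φ Ut (x, μ) (hf (shift μ x)) - hf x) := by
      rw [equiv_covDerivL2K, covDeriv_apply_dir]
    rw [← h1, hhdef, hUt, covDerivL2K_gaugeU, equiv_gaugeW]
  -- (2b) the bond differences of `h` over `y`
  have hbond : ∀ (x : TSite d (towerP L m (n + 1))) (μ : Fin d), (∀ i, (x i : ℕ) / L ^ (n + 1) = (y i : ℕ)) →
      (∀ i, ((shift μ x) i : ℕ) / L ^ (n + 1) = (y i : ℕ)) →
      ‖hf (shift μ x) - hf x‖ ^ 2 ≤ 2 * η ^ 2 * ‖Df (x, μ)‖ ^ 2 + 2 * ε ^ 2 * ‖f (shift μ x)‖ ^ 2 := by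
    intro x μ hx hxμ
    have hηC : ((η : ℂ)) ≠ 0 := by exact_mod_cast hη
    have e : hf (shift μ x) - hf x = (hf (shift μ x) - adTransportW φ Ut (x, μ) (hf (shift μ x))) +
        ((η : ℂ)) • (((η : ℂ))⁻¹ • (adTransportW φ Ut (x, μ) (hf (shift μ x)) - hf x)) := by
      rw [smul_smul, mul_inv_cancel₀ hηC, one_smul]; abel
    have h2 : ‖((η : ℂ)) • (((η : ℂ))⁻¹ • (adTransportW φ Ut (x, μ) (hf (shift μ x)) - hf x))‖ = |η| * ‖Df (x, μ)‖ := by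
      rw [hD, norm_smul, Complex.norm_real, Real.norm_eq_abs, norm_AdW_of_inner φ (hAd y x)]
    have h3 : ‖hf (shift μ x) - adTransportW φ Ut (x, μ) (hf (shift μ x))‖ ≤ ε * ‖f (shift μ x)‖ := by
      rw [← norm_neg, neg_sub, ← hnorm (shift μ x)]; exact hR y x μ hx hxμ _
    have h1 : ‖hf (shift μ x) - hf x‖ ≤ |η| * ‖Df (x, μ)‖ + ε * ‖f (shift μ x)‖ := by
      rw [e]; exact (norm_add_le _ _).trans (by rw [h2]; linarith [h3])
    have hp : 0 ≤ |η| * ‖Df (x, μ)‖ := by positivity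
    have hq : 0 ≤ ε * ‖f (shift μ x)‖ := by positivity
    have hsq : ‖hf (shift μ x) - hf x‖ * ‖hf (shift μ x) - hf x‖ ≤
        (|η| * ‖Df (x, μ)‖ + ε * ‖f (shift μ x)‖) * (|η| * ‖Df (x, μ)‖ + ε * ‖f (shift μ x)‖) :=
      mul_le_mul h1 h1 (norm_nonneg _) (by positivity)
    nlinarith [hsq, sq_nonneg (|η| * ‖Df (x, μ)‖ - ε * ‖f (shift μ x)‖), sq_abs η]
  -- (2c) the block mean of `h` IS `(Q′_k(1)h)(y)`; `‖(Q′_k(Ũ)h)(y)‖ = ‖(Q′_k(U)λ)(y)‖`; the local composite letter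
  have hflat : (fun j => adTransportW φ (UlevOf L m (n + 1) (fun _ : Bond d (towerP L m (n + 1)) => (1 : 𝔸ˣ)) j)) =
      fun _ _ => (LinearMap.id : W →ₗ[ℂ] W) := by
    funext j b; rw [B9Eq315QTowerFlat.UlevOf_one, B5Eq172HodgePositivity.adTransportW_one]
  have hmean_eq : N⁻¹ • ∑ x ∈ S', hf x = QprimeTowerW L m n φ (fun _ : Bond d (towerP L m (n + 1)) => (1 : 𝔸ˣ)) (c₀ := c₀) h y := by
    have h1 : QprimeTowerW L m n φ (fun _ : Bond d (towerP L m (n + 1)) => (1 : 𝔸ˣ)) (c₀ := c₀) h y =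
        QprimeTower L m (fun _ _ => (LinearMap.id : W →ₗ[ℂ] W)) (n + 1) hf y := by rw [QprimeTowerW, hflat]; rfl
    rw [h1, QprimeTower_flat_apply, Finset.smul_sum]
  have hQcov : ‖QprimeTowerW L m n φ Ut (c₀ := c₀) h y‖ = ‖QprimeTowerW L m n φ U (c₀ := c₀) lam y‖ := by
    rw [hhdef, hUt]; exact norm_QprimeTowerW_gaugeU L m hL hS n U hU (g y) (hgU1 y) hα hα3 hα2 h52 φ (hAd y) lam y
  have hsumf : ∑ x ∈ S', ‖WL2.equiv ℂ (fun _ : TSite d (towerP L m (n + 1)) => c₀) W h x‖ = ∑ x ∈ S', ‖f x‖ :=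
    Finset.sum_congr rfl fun x _ => hnorm x
  have hmean : ‖N⁻¹ • ∑ x ∈ S', hf x‖ ≤ ‖QprimeTowerW L m n φ U (c₀ := c₀) lam y‖ + ρ * (N⁻¹ * ∑ x ∈ S', ‖f x‖) := by
    have hloc := norm_QprimeTowerW_sub_flat_apply_le_local L m φ n Ut εlev hεlev y (hRlev y) h
    rw [← hS', hsumf, ← hρdef, ← hNdef] at hloc
    rw [hmean_eq, ← hQcov]
    exact (norm_le_insert (QprimeTowerW L m n φ Ut (c₀ := c₀) h y) _).trans (by linarith [hloc])
  have hmean_sq : ‖N⁻¹ • ∑ x ∈ S', hf x‖ ^ 2 ≤ 2 * ‖QprimeTowerW L m n φ U (c₀ := c₀) lam y‖ ^ 2 + 2 * ρ ^ 2 * (N⁻¹ * ∑ x ∈ S', ‖f x‖ ^ 2) := by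
    have hJ := overMean_norm_sq_le L m n (W := W) y f
    rw [← hS', ← hNdef] at hJ
    have hA : 0 ≤ ‖QprimeTowerW L m n φ U (c₀ := c₀) lam y‖ := norm_nonneg _
    have hBm : 0 ≤ N⁻¹ * ∑ x ∈ S', ‖f x‖ := mul_nonneg (by positivity) (Finset.sum_nonneg fun _ _ => norm_nonneg _)
    have hsq : ‖N⁻¹ • ∑ x ∈ S', hf x‖ * ‖N⁻¹ • ∑ x ∈ S', hf x‖ ≤
        (‖QprimeTowerW L m n φ U (c₀ := c₀) lam y‖ + ρ * (N⁻¹ * ∑ x ∈ S', ‖f x‖)) *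
          (‖QprimeTowerW L m n φ U (c₀ := c₀) lam y‖ + ρ * (N⁻¹ * ∑ x ∈ S', ‖f x‖)) := mul_le_mul hmean hmean (norm_nonneg _) (by positivity)
    have hρJ : ρ ^ 2 * (N⁻¹ * ∑ x ∈ S', ‖f x‖) ^ 2 ≤ ρ ^ 2 * (N⁻¹ * ∑ x ∈ S', ‖f x‖ ^ 2) := mul_le_mul_of_nonneg_left hJ (sq_nonneg _)
    nlinarith [hsq, hρJ, sq_nonneg (‖QprimeTowerW L m n φ U (c₀ := c₀) lam y‖ - ρ * (N⁻¹ * ∑ x ∈ S', ‖f x‖))]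
  -- (2a) Poincaré with means for `h` on the unit block and the bond differences
  have hPoinc := sum_over_norm_sq_le_poincare_mean L m n (W := W) y hf
  rw [← hS', ← hNdef] at hPoinc
  set T := Finset.univ.filter (fun b : Bond d (towerP L m (n + 1)) =>
      (∀ i, (b.1 i : ℕ) / L ^ (n + 1) = (y i : ℕ)) ∧ ∀ i, ((shift b.2 b.1) i : ℕ) / L ^ (n + 1) = (y i : ℕ)) with hT
  have hdiff : ∑ b ∈ T, ‖hf (shift b.2 b.1) - hf b.1‖ ^ 2 ≤ ∑ b ∈ T, (2 * η ^ 2 * ‖Df b‖ ^ 2 + 2 * ε ^ 2 * ‖f (shift b.2 b.1)‖ ^ 2) :=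
    Finset.sum_le_sum fun b hb => by
      rw [hT] at hb
      simp only [Finset.mem_filter, Finset.mem_univ, true_and] at hb
      exact hbond b.1 b.2 hb.1 hb.2
  have hlhs : ∑ x ∈ S', ‖f x‖ ^ 2 = ∑ x ∈ S', ‖hf x‖ ^ 2 := Finset.sum_congr rfl fun x _ => by rw [hnorm]
  have hP : 0 ≤ (((L ^ (n + 1) - 1 : ℕ) : ℝ)) * ((L ^ (n + 1) - 1 : ℕ) + 1) / 2 := by positivity
  have hmid : 2 * N * (2 * ρ ^ 2 * (N⁻¹ * ∑ x ∈ S', ‖f x‖ ^ 2)) = 4 * ρ ^ 2 * ∑ x ∈ S', ‖f x‖ ^ 2 := by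
    field_simp
    ring
  calc ∑ x ∈ S', ‖f x‖ ^ 2 = ∑ x ∈ S', ‖hf x‖ ^ 2 := hlhs
    _ ≤ 2 * ((((L ^ (n + 1) - 1 : ℕ) : ℝ)) * ((L ^ (n + 1) - 1 : ℕ) + 1) / 2) * ∑ b ∈ T, ‖hf (shift b.2 b.1) - hf b.1‖ ^ 2 +
          2 * N * ‖N⁻¹ • ∑ x ∈ S', hf x‖ ^ 2 := hPoinc
    _ ≤ 2 * ((((L ^ (n + 1) - 1 : ℕ) : ℝ)) * ((L ^ (n + 1) - 1 : ℕ) + 1) / 2) * ∑ b ∈ T, (2 * η ^ 2 * ‖Df b‖ ^ 2 + 2 * ε ^ 2 * ‖f (shift b.2 b.1)‖ ^ 2) +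
          2 * N * (2 * ‖QprimeTowerW L m n φ U (c₀ := c₀) lam y‖ ^ 2 + 2 * ρ ^ 2 * (N⁻¹ * ∑ x ∈ S', ‖f x‖ ^ 2)) := by
        gcongr
    _ = _ := by rw [mul_add (2 * N), hmid]; ring

end Block

/-! ## §3 Summed over the blocks, in the chain's weighted currency; §4 the strong form along Bałaban's normalisation -/

section Global

variable [∀ i, NeZero (m i)] {𝔸 : Type*} [NormedRing 𝔸] [NormOneClass 𝔸] [NormedAlgebra ℂ 𝔸] [CompleteSpace 𝔸]
  {W : Type*} [NormedAddCommGroup W] [InnerProductSpace ℂ W] [FiniteDimensional ℂ W] (φ : W ≃ₗ[ℂ] 𝔸) {c₀ c₁ : ℝ} [Fact (0 < c₀)] [Fact (0 < c₁)]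
  {η : ℝ} (hη : η ≠ 0) (hL : 2 ≤ L) {S : Subgroup 𝔸ˣ} (hS : AvgClosed d L S)
  (U : Bond d (towerP L m (n + 1)) → 𝔸ˣ) (hU : ∀ b, U b ∈ S)
  {α₀ : ℝ} (hα : 0 < α₀) (hα3 : C0 d * α₀ ≤ 1 / 3) (hα2 : 2 * α₀ ≤ c2' d L)
  (h52 : pdev (perCfg (towerP L m (n + 1)) U) < α₀ * (((L : ℝ) ^ (n + 1))⁻¹) ^ 2)
  (g : TSite d m → TSite d (towerP L m (n + 1)) → 𝔸ˣ) (hgU1 : ∀ y x, g y x ∈ U1 𝔸)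
  (hAd : ∀ (y : TSite d m) (x : TSite d (towerP L m (n + 1))) (v v' : W), ⟪AdW φ (g y x) v, AdW φ (g y x) v'⟫_ℂ = ⟪v, v'⟫_ℂ)
  {ε : ℝ} (hε : 0 ≤ ε) (εlev : ℕ → ℝ) (hεlev : ∀ j, 0 ≤ εlev j)
  (hR : ∀ (y : TSite d m) (x : TSite d (towerP L m (n + 1))) (μ : Fin d), (∀ i, (x i : ℕ) / L ^ (n + 1) = (y i : ℕ)) →
    (∀ i, ((shift μ x) i : ℕ) / L ^ (n + 1) = (y i : ℕ)) → ∀ w, ‖adTransportW φ (gaugeU (g y) U) (x, μ) w - w‖ ≤ ε * ‖w‖)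
  (hRlev : ∀ (y : TSite d m), ∀ j < n + 1, ∀ (x : TSite d (towerP L m (j + 1))) (μ : Fin d),
    blockCoord L (towerP L m j) x = blockCoord L (towerP L m j) (shift μ x) → (∀ i, (x i : ℕ) / L ^ (j + 1) = (y i : ℕ)) →
      ∀ w, ‖adTransportW φ (UlevOf L m (n + 1) (gaugeU (g y) U) j) (x, μ) w - w‖ ≤ εlev j * ‖w‖)

omit [NormOneClass 𝔸] [FiniteDimensional ℂ W] [Fact (0 < c₀)] in
/-- `‖Q̃′_k(U)λ‖² = c₁·Σ_y‖(Q′_k(U)λ)(y)‖²`. [cite: Balaban1985BackgroundPropagators, (3.19) p.393, (3.24) p.394] -/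
theorem norm_sq_QtildeTower (lam : SiteL2K ℂ d (towerP L m (n + 1)) c₀ W) :
    ‖((WL2.linearEquiv ℂ ℂ (fun _ : TSite d m => c₁)).symm.toLinearMap ∘ₗ QprimeTowerW L m n φ U (c₀ := c₀)) lam‖ ^ 2 =
      c₁ * ∑ y : TSite d m, ‖QprimeTowerW L m n φ U (c₀ := c₀) lam y‖ ^ 2 := by
  rw [WL2.norm_sq (𝕜 := ℂ) (w := fun _ : TSite d m => c₁) (V := W), Finset.mul_sum]
  refine Finset.sum_congr rfl fun y _ => ?_
  rw [LinearMap.comp_apply]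
  simp only [LinearEquiv.coe_coe, WL2.linearEquiv_symm_apply, Equiv.apply_symm_apply]

include hη hL hS hU hα hα3 hα2 h52 hgU1 hAd hε hεlev hR hRlev in
/-- **POINCARÉ WITH MEANS AT `U` FOR THE k-LEVEL SITE AVERAGING, IN THE CHAIN's LETTERS**: for EVERY gauge parameter `λ` of `T_{L^{n+1}m}`,
`(1 − κ_k)·‖λ‖² ≤ 2(N−1)Nη²·‖D_Uλ‖² + 4(c₀N^d∕c₁)·‖Q̃′_k(U)λ‖²`, `κ_k = 2d(N−1)N·ε² + 4ρ_k²`, `N = L^{n+1}` — §2 summed over the unit blocks, internal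
bonds ≤ all bonds, each site is `b₊` of `d` bonds, `‖λ‖² = c₀Σ‖λ x‖²`, `‖D_Uλ‖² = c₀Σ_b‖…‖²`, `‖Q̃′_kλ‖² = c₁Σ_y‖…‖²`.
[cite: Balaban1985BackgroundPropagators, (3.24) p.394, (3.31)–(3.32) p.395, Thm 3.11 p.416; Balaban1983RegularityDecay, (2.27) p.580] -/
theorem norm_sq_le_site_squares_blockGauge_tower (lam : SiteL2K ℂ d (towerP L m (n + 1)) c₀ W) :
    (1 - (2 * d * ((((L ^ (n + 1) - 1 : ℕ) : ℝ)) * ((L ^ (n + 1) - 1 : ℕ) + 1)) * ε ^ 2 +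
        4 * ((∏ j ∈ Finset.range (n + 1), (1 + εlev j) ^ (d * (L - 1))) - 1) ^ 2)) * ‖lam‖ ^ 2 ≤
      2 * ((((L ^ (n + 1) - 1 : ℕ) : ℝ)) * ((L ^ (n + 1) - 1 : ℕ) + 1)) * η ^ 2 * ‖covDerivL2K ℂ c₀ ((η : ℂ))⁻¹ (adTransportW φ U) lam‖ ^ 2 +
        4 * (c₀ * ((L : ℝ) ^ (n + 1)) ^ d / c₁) * ‖((WL2.linearEquiv ℂ ℂ (fun _ : TSite d m => c₁)).symm.toLinearMap ∘ₗ QprimeTowerW L m n φ U (c₀ := c₀)) lam‖ ^ 2 := by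
  classical
  have hc₀ : 0 < c₀ := Fact.out
  have hc₁ : 0 < c₁ := Fact.out
  set Nn : ℝ := (((L ^ (n + 1) - 1 : ℕ) : ℝ)) * ((L ^ (n + 1) - 1 : ℕ) + 1) with hNn
  set Nd : ℝ := ((L : ℝ) ^ (n + 1)) ^ d with hNd
  set f := WL2.equiv ℂ (fun _ : TSite d (towerP L m (n + 1)) => c₀) W lam with hfdef
  set Df := WL2.equiv ℂ (fun _ : Bond d (towerP L m (n + 1)) => c₀) W (covDerivL2K ℂ c₀ ((η : ℂ))⁻¹ (adTransportW φ U) lam) with hDf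
  set ρ := (∏ j ∈ Finset.range (n + 1), (1 + εlev j) ^ (d * (L - 1))) - 1 with hρdef
  set G : Bond d (towerP L m (n + 1)) → ℝ := fun b => 2 * η ^ 2 * ‖Df b‖ ^ 2 + 2 * ε ^ 2 * ‖f (shift b.2 b.1)‖ ^ 2 with hG
  have hG0 : ∀ b, 0 ≤ G b := fun b => by rw [hG]; positivity
  have hNn0 : 0 ≤ Nn := by rw [hNn]; positivity
  -- the three weighted norms
  have hlam : ‖lam‖ ^ 2 = c₀ * ∑ x, ‖f x‖ ^ 2 := by
    rw [WL2.norm_sq (𝕜 := ℂ) (w := fun _ : TSite d (towerP L m (n + 1)) => c₀) (V := W), Finset.mul_sum]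
  have hD : ‖covDerivL2K ℂ c₀ ((η : ℂ))⁻¹ (adTransportW φ U) lam‖ ^ 2 = c₀ * ∑ b, ‖Df b‖ ^ 2 := by
    rw [WL2.norm_sq (𝕜 := ℂ) (w := fun _ : Bond d (towerP L m (n + 1)) => c₀) (V := W), Finset.mul_sum]
  have hQ := norm_sq_QtildeTower L m n φ (c₁ := c₁) U lam
  -- §2 summed over the blocks
  have hblocks : ∑ x, ‖f x‖ ^ 2 ≤ Nn * ∑ b, G b + 4 * Nd * ∑ y, ‖QprimeTowerW L m n φ U (c₀ := c₀) lam y‖ ^ 2 + 4 * ρ ^ 2 * ∑ x, ‖f x‖ ^ 2 := by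
    rw [← sum_over_sum L m n (fun x => ‖f x‖ ^ 2)]
    have h1 := fun y => sum_over_norm_sq_le_blockGauge_tower L m n φ hη hL hS U hU hα hα3 hα2 h52 g hgU1 hAd hε εlev hεlev hR hRlev lam y
    refine (Finset.sum_le_sum fun y _ => h1 y).trans ?_
    rw [Finset.sum_add_distrib, Finset.sum_add_distrib, ← Finset.mul_sum, ← Finset.mul_sum, ← Finset.mul_sum]
    have hint := sum_bond_internal_le L m n G hG0
    have e2 : 2 * (Nn / 2) = Nn := by ring
    rw [e2]
    nlinarith [mul_le_mul_of_nonneg_left hint hNn0]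
  -- the bond sums
  have hGsum : ∑ b, G b = 2 * η ^ 2 * ∑ b, ‖Df b‖ ^ 2 + 2 * ε ^ 2 * (d * ∑ x, ‖f x‖ ^ 2) := by
    rw [hG]
    simp only
    rw [Finset.sum_add_distrib, ← Finset.mul_sum, ← Finset.mul_sum, sum_bond_tgt_eq_tower L m n (fun x => ‖f x‖ ^ 2)]
  rw [hGsum] at hblocks
  -- assemble in the weighted currency
  have hS0 : 0 ≤ ∑ x, ‖f x‖ ^ 2 := Finset.sum_nonneg fun _ _ => sq_nonneg _
  have key : c₀ * ∑ x, ‖f x‖ ^ 2 ≤ Nn * (2 * η ^ 2 * (c₀ * ∑ b, ‖Df b‖ ^ 2)) + 2 * d * Nn * ε ^ 2 * (c₀ * ∑ x, ‖f x‖ ^ 2) +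
      4 * (c₀ * Nd / c₁) * (c₁ * ∑ y, ‖QprimeTowerW L m n φ U (c₀ := c₀) lam y‖ ^ 2) + 4 * ρ ^ 2 * (c₀ * ∑ x, ‖f x‖ ^ 2) := by
    have h := mul_le_mul_of_nonneg_left hblocks hc₀.le
    have e : 4 * (c₀ * Nd / c₁) * (c₁ * ∑ y, ‖QprimeTowerW L m n φ U (c₀ := c₀) lam y‖ ^ 2) =
        c₀ * (4 * Nd * ∑ y, ‖QprimeTowerW L m n φ U (c₀ := c₀) lam y‖ ^ 2) := by field_simp
    rw [e]; nlinarith [h]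
  rw [hlam, hD, hQ]
  nlinarith [key]

variable (hRS : ∀ (b : Bond d (towerP L m (n + 1))) (v u : W), ⟪adTransportW φ U b v, u⟫_ℂ = ⟪v, adTransportW φ (fun b => (U b)⁻¹) b u⟫_ℂ)

include hη hRS hL hS hU hα hα3 hα2 h52 hgU1 hAd hε hεlev hR hRlev in
/-- **THE STRONG FORM OF `Δ′_{a′,k}(U)` AT A BACKGROUND WITH SMALL-BOND UNIT-BLOCK GAUGES, ALONG BAŁABAN's NORMALISATION** (`c₁(ηN)² = c₀N^d`,
`0 < ηN`, `a′ > 0`, `N = L^{n+1}`): `(1∕(3 + 4∕a′))·(‖D_Uλ‖² + (1 − κ_k)·(ηN)⁻²‖λ‖²) ≤ re⟨λ, Δ′_{a′,k}(U)λ⟩ = ‖D_Uλ‖² + a′‖Q̃′_k(U)λ‖²`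
(`re_inner_laplacePrimeAk`), `κ_k = 2d(N−1)N·ε² + 4ρ_k²` — §3 with `(N−1)Nη² ≤ (ηN)²`, `c₀N^d∕c₁ = (ηN)²`.  Print's «Δ′_a is positive» ∕ Thm 3.11 for
the k-LEVEL site operator at every background admitting such gauges; constants free of `m, η, c₀, c₁`; with (T2)'s profile `κ_k = O(α₀²)` level-free.
[cite: Balaban1985BackgroundPropagators, (3.24) p.394, p.395, (3.35) p.396, Thm 3.11 p.416; Balaban1984PropagatorsI, (1.18) p.20; Balaban1983RegularityDecay, (2.27) p.580] -/
theorem site_strong_coercive_blockGauge_tower {a' : ℝ} (ha' : 0 < a') (hηN0 : 0 < η * (L : ℝ) ^ (n + 1))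
    (hs : c₁ * (η * (L : ℝ) ^ (n + 1)) ^ 2 = c₀ * ((L : ℝ) ^ (n + 1)) ^ d) (lam : SiteL2K ℂ d (towerP L m (n + 1)) c₀ W) :
    (1 / (3 + 4 / a')) * (‖covDerivL2K ℂ c₀ ((η : ℂ))⁻¹ (adTransportW φ U) lam‖ ^ 2 +
        (1 - (2 * d * ((((L ^ (n + 1) - 1 : ℕ) : ℝ)) * ((L ^ (n + 1) - 1 : ℕ) + 1)) * ε ^ 2 +
          4 * ((∏ j ∈ Finset.range (n + 1), (1 + εlev j) ^ (d * (L - 1))) - 1) ^ 2)) * (((η * (L : ℝ) ^ (n + 1))⁻¹) ^ 2 * ‖lam‖ ^ 2)) ≤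
      RCLike.re ⟪lam, laplacePrimeAk L m n φ η U a' (c₁ := c₁) lam⟫_ℂ := by
  have hc₀ : 0 < c₀ := Fact.out
  have hc₁ : 0 < c₁ := Fact.out
  have hN1 : (1 : ℝ) ≤ (L : ℝ) ^ (n + 1) := by exact_mod_cast Nat.one_le_pow _ _ (Nat.pos_of_ne_zero (NeZero.ne L))
  rw [re_inner_laplacePrimeAk L m n φ η U a' hRS]
  set D := ‖covDerivL2K ℂ c₀ ((η : ℂ))⁻¹ (adTransportW φ U) lam‖ ^ 2 with hDdef
  set Q := ‖((WL2.linearEquiv ℂ ℂ (fun _ : TSite d m => c₁)).symm.toLinearMap ∘ₗ QprimeTowerW L m n φ U) lam‖ ^ 2 with hQdef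
  set Nn : ℝ := (((L ^ (n + 1) - 1 : ℕ) : ℝ)) * ((L ^ (n + 1) - 1 : ℕ) + 1) with hNn
  set κ := 2 * d * Nn * ε ^ 2 + 4 * ((∏ j ∈ Finset.range (n + 1), (1 + εlev j) ^ (d * (L - 1))) - 1) ^ 2 with hκ
  have hP := norm_sq_le_site_squares_blockGauge_tower L m n φ (c₁ := c₁) hη hL hS U hU hα hα3 hα2 h52 g hgU1 hAd hε εlev hεlev hR hRlev lam
  rw [← hDdef, ← hQdef, ← hNn, ← hκ] at hP
  have hratio : c₀ * ((L : ℝ) ^ (n + 1)) ^ d / c₁ = (η * (L : ℝ) ^ (n + 1)) ^ 2 := by rw [← hs]; field_simp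
  rw [hratio] at hP
  have hD0 : 0 ≤ D := by rw [hDdef]; positivity
  have hQ0 : 0 ≤ Q := by rw [hQdef]; positivity
  have hηN2 : 0 < (η * (L : ℝ) ^ (n + 1)) ^ 2 := by positivity
  -- `(N−1)N ≤ N²`: `Nn·η² ≤ (ηN)²`
  have hNn_le : Nn * η ^ 2 ≤ (η * (L : ℝ) ^ (n + 1)) ^ 2 := by
    have hcast : (((L ^ (n + 1) - 1 : ℕ) : ℝ)) + 1 = (L : ℝ) ^ (n + 1) := by
      have := Nat.sub_add_cancel (Nat.one_le_pow (n + 1) L (Nat.pos_of_ne_zero (NeZero.ne L)))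
      have h' : (((L ^ (n + 1) - 1 + 1 : ℕ) : ℝ)) = ((L ^ (n + 1) : ℕ) : ℝ) := by rw [this]
      push_cast at h'; linarith
    have hle : Nn ≤ ((L : ℝ) ^ (n + 1)) ^ 2 := by
      rw [hNn, hcast]
      have : (((L ^ (n + 1) - 1 : ℕ) : ℝ)) ≤ (L : ℝ) ^ (n + 1) := by linarith
      nlinarith
    nlinarith [sq_nonneg η]
  -- `(1 − κ)(ηN)⁻²‖λ‖² ≤ 2D + 4Q`
  have hmass : (1 - κ) * (((η * (L : ℝ) ^ (n + 1))⁻¹) ^ 2 * ‖lam‖ ^ 2) ≤ 2 * D + 4 * Q := by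
    have h1 : 2 * Nn * η ^ 2 * D ≤ 2 * (η * (L : ℝ) ^ (n + 1)) ^ 2 * D := by nlinarith
    have h2 : (1 - κ) * ‖lam‖ ^ 2 ≤ (η * (L : ℝ) ^ (n + 1)) ^ 2 * (2 * D + 4 * Q) := by nlinarith
    have h3 : (1 - κ) * (((η * (L : ℝ) ^ (n + 1))⁻¹) ^ 2 * ‖lam‖ ^ 2) = ((η * (L : ℝ) ^ (n + 1)) ^ 2)⁻¹ * ((1 - κ) * ‖lam‖ ^ 2) := by
      rw [inv_pow]; ring
    rw [h3, inv_mul_le_iff₀ hηN2]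
    exact h2
  have ha3 : 0 < 3 + 4 / a' := by positivity
  rw [one_div, inv_mul_le_iff₀ ha3]
  have hexp : (3 + 4 / a') * (D + a' * Q) = 3 * D + 4 * Q + (4 / a') * D + 3 * (a' * Q) := by
    field_simp
    ring
  rw [hexp]
  have h4 : 0 ≤ (4 / a') * D := by positivity
  have h5 : 0 ≤ a' * Q := by positivity
  linarith [hmass]

end Global

end Literature.MathematicalPhysics.QuantumFieldTheory.Balaban1983to89.B9Thm311SitePrimeFormCoerciveTowerBlockGauge

end
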